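import Mathlib.NumberTheory.Padics.PadicVal.Basic
import Mathlib.Analysis.SpecialFunctions.Pow.Real
import Mathlib.FieldTheory.Separable
import HarnessLib

/-!
# `S`-parts of values of univariate polynomials (Bugeaud–Evertse–Győry 2018, Thm. 2.1 (i); `p`-adic Thue–Siegel–Roth)

Topic `Literature/NumberTheory/DiophantineApproximation`. Cite item wi-30254 (route `Parity/BatemanHorn`,
crux `LSDRealSegment` stmt-Parity-9770, line `shared-kernel-uncapped-transfer`, stub `stub_spikeControl`:
"no `p`-adic spikes" of `∏ᵢ fᵢ(n)`).

## Source (read: arXiv:1708.08290 = Acta Arith. 184 (2018) 151–185, §1, §2.1, §3)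

Y. Bugeaud, J.-H. Evertse, K. Győry [BugeaudEvertseGyory2018]. §1: for a finite non-empty set of
primes `S = {p₁, …, p_s}` and a non-zero integer `m = p₁^{a₁} ⋯ p_s^{a_s} b` with `gcd(b, p₁⋯p_s) = 1`,
the **`S`-part** of `m` is `[m]_S := p₁^{a₁} ⋯ p_s^{a_s}` (`= ∏_{p ∈ S} p^{v_p(m)}`; `sPart` below).
**Theorem 2.1.** *Let `f(X) ∈ ℤ[X]` be a polynomial of degree `n ≥ 2` without multiple zeros.
(i) Let `S = {p₁, …, p_s}` be a non-empty set of primes. Then for every `ε > 0` and for every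
`x ∈ ℤ` with `f(x) ≠ 0`, `[f(x)]_S ≪_{f,S,ε} |f(x)|^{(1/n)+ε}`.* (Vinogradov notation, §2.1: the
implied constant depends only on `f, S, ε`.) (ii) — the exponent `1/n` is optimal — is NOT vendored.
Proof (§3): Prop. 3.1, *"a very well-known consequence of the `p`-adic Thue–Siegel–Roth Theorem. The
only reference we could find for it is [Mahler 1961]"*: for a binary form `F ∈ ℤ[X,Y]` of degree
`n ≥ 2` with non-zero discriminant, `|F(x,y)|/[F(x,y)]_S ≫_{F,S,ε} max(|x|,|y|)^{n−2−ε}` on coprime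
pairs; applied to `Y^{n+1} f(X/Y)` at `(x, 1)` it gives `|f(x)|/[f(x)]_S ≫ |x|^{n−1−nε} ≫ |f(x)|^{(n−1−nε)/n}`.
The `p`-adic Roth theorem is [Ridout1958] (not held; restated as [BombieriGubler2006] Thm. 6.2.3).

## Rendering

* `sPart S m = ∏_{p ∈ S} p ^ (padicValInt p m)` for a finset `S` of natural numbers (meant: primes)
  and `m : ℤ`; for `m = 0` Mathlib's junk value `padicValInt p 0 = 0` gives `sPart S 0 = 1`, harmless
  since the theorem only speaks about `f(x) ≠ 0`.
* "degree `n ≥ 2` without multiple zeros": `2 ≤ f.natDegree` and `f` SEPARABLE OVER `ℚ`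
  (`(f.map (Int.castRingHom ℚ)).Separable`; in characteristic `0` this is "squarefree over `ℚ`" =
  "no multiple complex zeros" = "non-zero discriminant"; separability over `ℤ` itself would be
  stronger, e.g. `2X` is not `ℤ`-separable).
* "`≪_{f,S,ε}`": an existential constant `C > 0` after `f, S, ε` are fixed.
* The set `S` is a non-empty finset of primes, as printed; `…of_primes` below drops non-emptiness
  (for `S = ∅` the bound is trivial) and `…le_pow_max` converts `|f(x)|^{1/n+ε}` into the shape
  `max(1,|x|)^{1+nε}` used by the consumer (`|f(x)| ≤ H(f) max(1,|x|)^n`, proved).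

## Contents

* `sPart`, `sPart_empty`, `one_le_sPart` — the `S`-part and two sanity lemmas (proved).
* `BugeaudEvertseGyory2018_SPartPolynomialValues` — NAMED FACT, Thm. 2.1 (i) as printed.
* `BugeaudEvertseGyory2018_SPartPolynomialValues.of_primes` — same without `S.Nonempty` (proved
  from the fact).
* `abs_eval_le_height_mul_pow` — `|f(x)| ≤ (∑ᵢ |aᵢ|) · max(1,|x|)^{deg f}` (proved, elementary).
* `BugeaudEvertseGyory2018_SPartPolynomialValues.le_pow_max` — `[f(x)]_S ≤ C · max(1,|x|)^{1 + nε}`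
  (proved from the fact).

## References

* [BugeaudEvertseGyory2018] Y. Bugeaud, J.-H. Evertse, K. Győry, *`S`-parts of values of univariate
  polynomials, binary forms and decomposable forms at integral points*, Acta Arith. 184 (2018)
  151–185, arXiv:1708.08290: §1 (definition of `[m]_S`), Thm. 2.1 (i), Prop. 3.1 and the proof of
  Thm. 2.1 in §3.
* [Ridout1958] D. Ridout, *The `p`-adic generalization of the Thue–Siegel–Roth theorem*, Mathematika 5
  (1958) 40–48.
* [BombieriGubler2006] E. Bombieri, W. Gubler, *Heights in Diophantine Geometry*, Thm. 6.2.3.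
-/

noncomputable section

open Polynomial Finset

namespace Literature.NumberTheory.DiophantineApproximation

/-! ### The `S`-part of an integer -/

/-- The **`S`-part** `[m]_S = ∏_{p ∈ S} p^{v_p(m)}` of an integer `m` with respect to a finite set `S`
of (prime) numbers (Bugeaud–Evertse–Győry 2018, §1: `m = p₁^{a₁}⋯p_s^{a_s} b`, `gcd(b, p₁⋯p_s) = 1`,
`[m]_S := p₁^{a₁}⋯p_s^{a_s}`). Junk value `sPart S 0 = 1`. [cite: BugeaudEvertseGyory2018, §1] -/
def sPart (S : Finset ℕ) (m : ℤ) : ℕ := ∏ p ∈ S, p ^ padicValInt p m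

/-- The `∅`-part of any integer is `1`. [cite: BugeaudEvertseGyory2018, §1] -/
@[simp] theorem sPart_empty (m : ℤ) : sPart ∅ m = 1 := by simp [sPart]

/-- An `S`-part over a set of primes (indeed of positive numbers) is `≥ 1`. [cite: BugeaudEvertseGyory2018, §1] -/
theorem one_le_sPart {S : Finset ℕ} (hS : ∀ p ∈ S, p.Prime) (m : ℤ) : 1 ≤ sPart S m := by
  unfold sPart
  exact Finset.one_le_prod' fun p hp => Nat.one_le_pow _ _ (hS p hp).pos

/-! ### The named fact -/

/-- NAMED FACT — **Bugeaud–Evertse–Győry 2018, Theorem 2.1 (i)** (a consequence of the `p`-adic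
Thue–Siegel–Roth theorem of Ridout 1958 / Mahler 1961, loc. cit. Prop. 3.1): *let `f ∈ ℤ[X]` have
degree `n ≥ 2` and no multiple zeros, and let `S` be a finite non-empty set of primes; then for every
`ε > 0`, `[f(x)]_S ≪_{f,S,ε} |f(x)|^{1/n + ε}` for every `x ∈ ℤ` with `f(x) ≠ 0`* — i.e. there is
`C = C(f,S,ε) > 0` with `∏_{p ∈ S} p^{v_p(f(x))} ≤ C |f(x)|^{1/n+ε}` whenever `f(x) ≠ 0`. Ineffective
(Roth); the effective version with exponent `1 − κ₁` is their Thm. 2.2 (not vendored), optimality of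
`1/n` their Thm. 2.1 (ii) (not vendored). "No multiple zeros" is rendered as separability of `f` over
`ℚ`. Users take `(h : BugeaudEvertseGyory2018_SPartPolynomialValues)`.
[cite: BugeaudEvertseGyory2018, Thm. 2.1 (i) (with §1 for [m]_S and Prop. 3.1 / §3 for the proof via the p-adic Thue–Siegel–Roth theorem = Ridout1958)] -/
def BugeaudEvertseGyory2018_SPartPolynomialValues : Prop :=
  ∀ (f : ℤ[X]), 2 ≤ f.natDegree → (f.map (Int.castRingHom ℚ)).Separable →
    ∀ (S : Finset ℕ), (∀ p ∈ S, p.Prime) → S.Nonempty →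
      ∀ ε : ℝ, 0 < ε → ∃ C : ℝ, 0 < C ∧ ∀ x : ℤ, f.eval x ≠ 0 →
        (sPart S (f.eval x) : ℝ) ≤ C * |((f.eval x : ℤ) : ℝ)| ^ ((1 : ℝ) / f.natDegree + ε)

/-! ### Consequences (proved) -/

/-- Under the named fact: the same bound for EVERY finite set of primes `S`, the empty set included
(there `[f(x)]_∅ = 1 ≤ |f(x)|^{1/n+ε}` because `f(x)` is a non-zero integer).
[cite: BugeaudEvertseGyory2018, Thm. 2.1 (i)] -/
theorem BugeaudEvertseGyory2018_SPartPolynomialValues.of_primes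
    (h : BugeaudEvertseGyory2018_SPartPolynomialValues) (f : ℤ[X]) (hdeg : 2 ≤ f.natDegree)
    (hsep : (f.map (Int.castRingHom ℚ)).Separable) (S : Finset ℕ) (hS : ∀ p ∈ S, p.Prime)
    {ε : ℝ} (hε : 0 < ε) :
    ∃ C : ℝ, 0 < C ∧ ∀ x : ℤ, f.eval x ≠ 0 →
      (sPart S (f.eval x) : ℝ) ≤ C * |((f.eval x : ℤ) : ℝ)| ^ ((1 : ℝ) / f.natDegree + ε) := by
  rcases S.eq_empty_or_nonempty with rfl | hne
  · refine ⟨1, one_pos, fun x hx => ?_⟩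
    have h1 : (1 : ℝ) ≤ |((f.eval x : ℤ) : ℝ)| := by
      rw [← Int.cast_abs]
      exact_mod_cast Int.one_le_abs hx
    have hexp : (0 : ℝ) ≤ 1 / (f.natDegree : ℝ) + ε := by positivity
    simpa using Real.one_le_rpow h1 hexp
  · exact h f hdeg hsep S hS hne ε hε

/-- Elementary height bound: `|f(x)| ≤ (∑_{i ≤ deg f} |aᵢ|) · max(1, |x|)^{deg f}` for `f ∈ ℤ[X]`,
`x ∈ ℤ` (triangle inequality on `f(x) = ∑ aᵢ xⁱ`). [folklore] -/
theorem abs_eval_le_height_mul_pow (f : ℤ[X]) (x : ℤ) :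
    |((f.eval x : ℤ) : ℝ)| ≤ (∑ i ∈ range (f.natDegree + 1), |(f.coeff i : ℝ)|) *
      (max 1 |(x : ℝ)|) ^ f.natDegree := by
  have hx : ((f.eval x : ℤ) : ℝ) = ∑ i ∈ range (f.natDegree + 1), (f.coeff i : ℝ) * (x : ℝ) ^ i := by
    rw [eval_eq_sum_range]
    push_cast
    rfl
  rw [hx, sum_mul]
  refine (abs_sum_le_sum_abs _ _).trans (sum_le_sum fun i hi => ?_)
  rw [abs_mul, abs_pow]
  refine mul_le_mul_of_nonneg_left ?_ (abs_nonneg _)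
  have hi' : i ≤ f.natDegree := Nat.lt_succ_iff.mp (mem_range.mp hi)
  calc |(x : ℝ)| ^ i ≤ (max 1 |(x : ℝ)|) ^ i :=
        pow_le_pow_left₀ (abs_nonneg _) (le_max_right _ _) i
    _ ≤ (max 1 |(x : ℝ)|) ^ f.natDegree := pow_le_pow_right₀ (le_max_left _ _) hi'

/-- Under the named fact, the shape used for "no `p`-adic spikes" (`stub_spikeControl`): for `f ∈ ℤ[X]`
of degree `n ≥ 2` without multiple zeros, a finite set of primes `S` and `ε > 0` there is `C > 0` with
`[f(x)]_S ≤ C · max(1,|x|)^{1 + nε}` whenever `f(x) ≠ 0` (from `|f(x)| ≤ H max(1,|x|)^n` and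
`n (1/n + ε) = 1 + nε`; cf. loc. cit. §3: `|f(x)|/[f(x)]_S ≫ |x|^{n−1−nε}`).
[cite: BugeaudEvertseGyory2018, Thm. 2.1 (i) and its proof in §3] -/
theorem BugeaudEvertseGyory2018_SPartPolynomialValues.le_pow_max
    (h : BugeaudEvertseGyory2018_SPartPolynomialValues) (f : ℤ[X]) (hdeg : 2 ≤ f.natDegree)
    (hsep : (f.map (Int.castRingHom ℚ)).Separable) (S : Finset ℕ) (hS : ∀ p ∈ S, p.Prime)
    {ε : ℝ} (hε : 0 < ε) :
    ∃ C : ℝ, 0 < C ∧ ∀ x : ℤ, f.eval x ≠ 0 →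
      (sPart S (f.eval x) : ℝ) ≤ C * (max 1 |(x : ℝ)|) ^ (1 + f.natDegree * ε) := by
  obtain ⟨C, hC, hb⟩ := h.of_primes f hdeg hsep S hS hε
  set n : ℕ := f.natDegree with hn
  set H : ℝ := ∑ i ∈ range (n + 1), |(f.coeff i : ℝ)| with hH
  set e : ℝ := (1 : ℝ) / n + ε with he
  have hnpos : (0 : ℝ) < n := by exact_mod_cast (lt_of_lt_of_le two_pos hdeg)
  have he0 : 0 ≤ e := by positivity
  have hH0 : 0 ≤ H := sum_nonneg fun i _ => abs_nonneg _
  refine ⟨C * (max 1 H) ^ e, by positivity, fun x hx => ?_⟩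
  have hM : (1 : ℝ) ≤ max 1 |(x : ℝ)| := le_max_left _ _
  have hM0 : (0 : ℝ) ≤ max 1 |(x : ℝ)| := zero_le_one.trans hM
  -- `|f(x)| ≤ max(1,H) · M^n`
  have hfx : |((f.eval x : ℤ) : ℝ)| ≤ max 1 H * (max 1 |(x : ℝ)|) ^ n :=
    (abs_eval_le_height_mul_pow f x).trans
      (mul_le_mul_of_nonneg_right (le_max_right _ _) (pow_nonneg hM0 _))
  have hne : (n : ℝ) * e = 1 + n * ε := by
    rw [he, mul_add, mul_one_div_cancel hnpos.ne']
  calc (sPart S (f.eval x) : ℝ) ≤ C * |((f.eval x : ℤ) : ℝ)| ^ e := hb x hx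
    _ ≤ C * (max 1 H * (max 1 |(x : ℝ)|) ^ n) ^ e := by
        gcongr
    _ = C * (max 1 H) ^ e * ((max 1 |(x : ℝ)|) ^ n) ^ e := by
        rw [Real.mul_rpow (zero_le_one.trans (le_max_left _ _)) (pow_nonneg hM0 _), mul_assoc]
    _ = C * (max 1 H) ^ e * (max 1 |(x : ℝ)|) ^ (1 + n * ε) := by
        rw [← Real.rpow_natCast (max 1 |(x : ℝ)|) n, ← Real.rpow_mul hM0, hne]

end Literature.NumberTheory.DiophantineApproximation

end
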